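import Mathlib
import Summits.Ventures.PercRepro2.CoinD31PrsCellsA
import Summits.Ventures.PercRepro2.CoinD31PrsCellsB
import Summits.Ventures.PercRepro2.CoinD31PrsCellsC
import Summits.Ventures.PercRepro2.CoinD31PrsCellsD
import Summits.Ventures.PercRepro2.CoinD31PrsCellsE
import Summits.Ventures.PercRepro2.CoinD31PrsCellsF
import Summits.Ventures.PercRepro2.CoinD31PrsCellsG
import Summits.Ventures.PercRepro2.CoinD31PrsCellsH
import Summits.Ventures.PercRepro2.CoinD31PrsCellsI
import Summits.Ventures.PercRepro2.CoinD31PrsCellsJ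
import Summits.Ventures.PercRepro2.CoinD31PrsCellsK
import Summits.Ventures.PercRepro2.CoinD31PrsCellsL
import Summits.Ventures.PercRepro2.CoinD31PrsCellsM
import Summits.Ventures.PercRepro2.CoinD31PrsCellsN
import Summits.Ventures.PercRepro2.CoinD31PrsCellsO
import Summits.Ventures.PercRepro2.CoinD31PrsAlg
import Summits.Ventures.PercRepro2.Defs
import Summits.Ventures.PercRepro2.Harris
import Summits.Ventures.PercRepro2.Independence
import Summits.Ventures.PercRepro2.CoinDefs
import Summits.Ventures.PercRepro2.CoinReverse
import Summits.Ventures.PercRepro2.CoinStarDefs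
import Summits.Ventures.PercRepro2.CoinLsmCoreDefs
import Summits.Ventures.PercRepro2.CoinLsmCoreU
import Summits.Ventures.PercRepro2.CoinCoreGate
import Summits.Ventures.PercRepro2.CoinTreeCore
import Summits.Ventures.PercRepro2.CoinOrTailAlg
import Summits.Ventures.PercRepro2.CoinOrTailDefs
import Summits.Ventures.PercRepro2.CoinOrTail3Cells
import Summits.Ventures.PercRepro2.CoinOrTail4Cells
import Summits.Ventures.PercRepro2.CoinOrTailLsmDefs
import Summits.Ventures.PercRepro2.CoinOrTailLsmSums
import Summits.Ventures.PercRepro2.CoinTreeAncestor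
import Summits.Ventures.PercRepro2.CoinOrTailFar2Alg

/-!
# Row 2′DARC at the OR-tail with BOTH MARKERS FAR ON ONE ROUTE, at every head (blind cell
PercRepro2, night-2 g9; proofs/NIGHT2-DARC.md §38)

`darc_of_orTailLsmFar2`: a closed-in core `U` with a log-supermodular law, the tail entered at
`u, q ∈ U`, two cut vertices `p, r ∈ U` above `u` (`p` above `r`: every cluster satisfies
`u ∈ W → r ∈ W → p ∈ W`); the MARKERS are `p` and `r` — both strictly above the attachment point
of their route, the other entry unmarked.  The abstract functional is
`orTailFar2_functional_nonneg`: the staged certificate `D31Prs_cert` of the (3,1) core with the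
markers `p, r` (9,512 terms, nine lsm and five same-cell monotone steps) lifted by
Ahlswede–Daykin.  Corollary `darc_of_orTailTreeFar2`: `U` an out-tree with `p` above `r` above
`u` — every directed two-route core with the markers `p_m, p_n` on route 1 (`m < n < k`), the
second route unmarked.  With §35–§38 this closes every placement of two markers on the routes of
a directed two-route core except «one far marker on each route».
-/

namespace Summit.Ventures.PercRepro2.Coin

open Classical

section OrTailFar2Main

variable {V : Type*} {E : Type*} [Fintype V] [DecidableEq V] [Fintype E] [DecidableEq E]
  {R : Type*} [Field R] [LinearOrder R] [IsStrictOrderedRing R]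
  {arcs : E → Finset (V × V)} {s : V} {U : Finset V} {p q a w : V} {cρ cτ : E}

/-- **THEOREM (both markers FAR on one route, on a log-supermodular core).**  The tail entered at
`u, q ∈ U`; `p, r ∈ U` with every cluster of `U` satisfying `u ∈ W → r ∈ W → p ∈ W` (`hcut2`: two cut
vertices above the attachment point `u`, `p` above `r`); the markers are `p` and `r`, the other
entry `q` unmarked. -/
theorem darc_of_orTailLsmFar2 (pr : E → R) (hp : IsProbVec pr) (hS : SameEnds arcs) {r u : V}
    (h : OrTailU arcs s U u q a cρ cτ) (hpU : p ∈ U) (hrU : r ∈ U)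
    (hcut2 : ∀ W ⊆ U, ¬ ((u ∈ W → r ∈ W) ∧ (r ∈ W → p ∈ W)) → prob pr (coreLevel arcs s U W) = 0)
    (hν : ∀ W W', W ⊆ U → W' ⊆ U →
      prob pr (coreLevel arcs s U W) * prob pr (coreLevel arcs s U W') ≤
        prob pr (coreLevel arcs s U (W ∩ W')) * prob pr (coreLevel arcs s U (W ∪ W')))
    {t : V} (htC : t ∉ insert a U) (hts : t ≠ s) (hws : w ≠ s) (hwC : w ∉ insert a U) :
    DARC pr arcs s {t} p r a w := by
  have hC := h.closedInCoreU
  have hpa : p ≠ a := fun e => h.a_notin (e ▸ hpU)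
  have hpC : p ∈ insert a U := Finset.mem_insert_of_mem hpU
  have hrC : r ∈ insert a U := Finset.mem_insert_of_mem hrU
  have haC : a ∈ insert a U := Finset.mem_insert_self _ _
  unfold DARC
  rw [hC.phiC_gate_eq pr hS htC hts hpC hrC haC hws hwC]
  have hm1 : ∀ W : Finset V, (fun _ : Finset V => (1 : R)) (insert a W) = (fun _ => (1 : R)) W :=
    fun _ => rfl
  have hmp : ∀ W : Finset V, (fun W : Finset V => if p ∈ W then (1 : R) else 0) (insert a W) =
      (fun W : Finset V => if p ∈ W then (1 : R) else 0) W := by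
    intro W; simp only [Finset.mem_insert, hpa, false_or]
  have hra : r ≠ a := fun e => h.a_notin (e ▸ hrU)
  have hmq : ∀ W : Finset V, (fun W : Finset V => if r ∈ W then (1 : R) else 0) (insert a W) =
      (fun W : Finset V => if r ∈ W then (1 : R) else 0) W := by
    intro W; simp only [Finset.mem_insert, hra, false_or]
  have hmpq : ∀ W : Finset V,
      (fun W : Finset V => (if p ∈ W then (1 : R) else 0) * (if r ∈ W then (1 : R) else 0))
        (insert a W) =
      (fun W : Finset V => (if p ∈ W then (1 : R) else 0) * (if r ∈ W then (1 : R) else 0)) W := by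
    intro W; simp only [Finset.mem_insert, hpa, hra, false_or]
  have eΛ := h.sum_R_eq pr t (fun _ => (1 : R)) hm1
  have eFa := h.sum_R_eq pr t (fun W => if p ∈ W then (1 : R) else 0) hmp
  have eFb := h.sum_R_eq pr t (fun W => if r ∈ W then (1 : R) else 0) hmq
  have eM := h.sum_G_eq (w := w) pr t (fun _ => (1 : R)) hm1
  have eX := h.sum_G_eq (w := w) pr t (fun W => if p ∈ W then (1 : R) else 0) hmp
  have eY := h.sum_G_eq (w := w) pr t (fun W => if r ∈ W then (1 : R) else 0) hmq
  have eXY := h.sum_G_eq (w := w) pr t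
    (fun W => (if p ∈ W then (1 : R) else 0) * (if r ∈ W then (1 : R) else 0)) hmpq
  simp only [mul_one] at eΛ eM
  rw [eΛ, eFa, eFb, eM, eX, eY, eXY]
  obtain ⟨hA0, hAmono, hAlsm⟩ := OrTailU.head_props (U := U) (a := a) pr hp hS t
  exact orTailFar2_functional_nonneg U (fun W => prob pr (coreLevel arcs s U W))
    (fun X => prob pr (coreAvoidEvent arcs s t (insert a U) X)) p r u q a w (pr cρ) (pr cτ)
    h.a_notin (fun hw => hwC (Finset.mem_insert_of_mem hw)) (hp.nonneg cρ) (hp.le_one cρ)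
    (hp.nonneg cτ) (hp.le_one cτ) (fun W => prob_nonneg hp _)
    (fun s' hs' t' ht' => hν s' t' hs' ht') (fun W hW hb => hcut2 W hW hb) hA0 hAlsm hAmono

/-- **COROLLARY (out-tree, both markers far on one route).**  `U` an out-tree, `r = par^[i] u`
and `p = par^[j] r` with the intermediate vertices in `U`. -/
theorem darc_of_orTailTreeFar2 (pr : E → R) (hp : IsProbVec pr) (hS : SameEnds arcs) {r u : V}
    (h : OrTailU arcs s U u q a cρ cτ)
    {c : V → E} {par : V → V} {rk : V → ℕ} (hU : TreeCore arcs s U c par rk)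
    (hpU : p ∈ U) (hrU : r ∈ U)
    {i : ℕ} (hi : ∀ k < i, par^[k] u ∈ U) (hir : par^[i] u = r)
    {j : ℕ} (hj : ∀ k < j, par^[k] r ∈ U) (hjp : par^[j] r = p)
    {t : V} (htC : t ∉ insert a U) (hts : t ≠ s) (hws : w ≠ s) (hwC : w ∉ insert a U) :
    DARC pr arcs s {t} p r a w := by
  refine darc_of_orTailLsmFar2 pr hp hS h hpU hrU ?_ (hU.coreLevel_lsm pr hp) htC hts hws hwC
  intro W _ hbad
  have hempty : coreLevel arcs s U W = ∅ := by
    ext ω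
    simp only [Set.mem_empty_iff_false, iff_false]
    intro hω
    apply hbad
    constructor
    · intro huW
      have hu : Reach arcs ω s u := (mem_coreLevel.mp hω u h.p_mem).mp huW
      have hr : Reach arcs ω s r := hir ▸ hU.reach_iterate_par hu i hi
      exact (mem_coreLevel.mp hω r hrU).mpr hr
    · intro hrW
      have hr : Reach arcs ω s r := (mem_coreLevel.mp hω r hrU).mp hrW
      have hpr : Reach arcs ω s p := hjp ▸ hU.reach_iterate_par hr j hj
      exact (mem_coreLevel.mp hω p hpU).mpr hpr
  rw [hempty, prob_empty]

end OrTailFar2Main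

end Summit.Ventures.PercRepro2.Coin
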